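import Mathlib
import HarnessLib.Audit
import Summits.PneNP.PneNP.Theorems.PstarSlackTwoClean

/-!
# An X-connected terminal core with a centre has two dirty chords — every slack (ROUND-24, O1; all sharing patterns; memo g25 §51)

FRONTIER range-avoidance ladder, rung F-N3, ROUND 24 (cell `pnp-ideate`, prover-2 memo `g25/O1-XORSPLIT-g25.md` §51; typed targets
`PstarCoreBoundTargets.TerminalFive` / `TerminalPeelable` (p646951); restricted-model proof complexity — nothing here bears on `P` versus `NP`).

The deletion inequality of `PstarSlackTwoClean` (`card_bdry_sdiff_add_le`) is slack-free, and so is the count it feeds.  At boundary slack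
`t := 2·#bdry K − 3·#K` (any `t`), with `C''` the fat clean chords, `Y` the non-centre vertices of degree `≠ 2`, `𝒟` the dirty chords
(chords that are not outside-gated) and `W₁` the vertices all of whose members but one are fat:

* refined injection + skeleton span (`skel = nonchords ∪ 𝒟`, `#xverts K ≤ #skel`, `2·#nonchords ≤ #K − t`): `#C'' ≥ t + 3 − 2·#𝒟 + #Y`;
* deletion of all fat chords but one at each vertex of `W₁ ⊆ Y`: `#C'' ≤ t + #W₁ ≤ t + #Y`.

Hence **`no_centre_of_dirty_le_one`**: inside the core-bound induction, an X-connected terminal core with AT MOST ONE dirty chord has no centre —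
for every slack and every sharing pattern; corollaries `no_centre_of_clean` and **`exists_two_dirty_of_centre`** (a centre forces two distinct
dirty chords, hence — `PstarChordReadTwoCleanCount.card_dirty_le_slack` — slack `≥ 2` once more).  This supersedes the slack layers `0, 1, 2` of
`PstarSlackAssembly*` for the census: see `PstarDirtyAssembly`.
-/

set_option linter.dupNamespace false -- `Summit.PneNP.PneNP.…`: summit = sub-problem name (D-0017 single-conjunct layout)

open Finset Literature.Computability.Complexity
open Summit.PneNP.PneNP.Theorems.PstarTyped (Typed)
open Summit.PneNP.PneNP.Theorems.PstarSALevel (varSet bdry BoundaryExpanding SimpleOverlap)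
open Summit.PneNP.PneNP.Theorems.PstarSAClosure (degIn mem_bdry_iff)
open Summit.PneNP.PneNP.Theorems.PstarXCore (xpair mem_xpair xverts)
open Summit.PneNP.PneNP.Theorems.PstarCentreFree (vars_mem_varSet)
open Summit.PneNP.PneNP.Theorems.PstarCoreBound (XorClosed)
open Summit.PneNP.PneNP.Theorems.PstarChordRepair (IsChord)
open Summit.PneNP.PneNP.Theorems.PstarCoreBoundTargets (Terminal nonchords mem_nonchords)
open Summit.PneNP.PneNP.Theorems.PstarSharingBound (sharedSlots card_bdry_add_card_sharedSlots_le)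
open Summit.PneNP.PneNP.Theorems.PstarChordBridgeTools (xpdeg)
open Summit.PneNP.PneNP.Theorems.PstarChordBridgeExchange (mem_xverts_iff)
open Summit.PneNP.PneNP.Theorems.PstarNorUnitCoverTools (exists_ne_of_two_le_xpdeg)
open Summit.PneNP.PneNP.Theorems.PstarChordReadOutside (OutsideGated)
open Summit.PneNP.PneNP.Theorems.PstarCleanChordCount (card_nonchords_le_card_sharedSlots)
open Summit.PneNP.PneNP.Theorems.PstarNoFreeVertex (covered_of_terminal mem_varSet_of_mem_xpair mem_xpair_of_mem_varSet)
open Summit.PneNP.PneNP.Theorems.PstarSkeletonSpan (XConnected skel mem_skel skel_subset card_xverts_le_card_skel xverts_mono)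
open Summit.PneNP.PneNP.Theorems.PstarSlackTools (three_le_card_xverts_of_leafless two_le_degIn)
open Summit.PneNP.PneNP.Theorems.PstarSlackTwoTools (card_deg2_chords_le_filter)
open Summit.PneNP.PneNP.Theorems.PstarSlackTwoClean (card_bdry_sdiff_add_le)

namespace Summit.PneNP.PneNP.Theorems.PstarCentreTwoDirty

variable {n m : ℕ}

variable {I : LocalMap 4 n m} {r : ℕ} {y : Fin m → Bool} {K : Finset (Fin m)} {w₁ w₂ : Finset (Fin n) × Finset (Fin m) × Bool}

/-- **NO CENTRE WITH AT MOST ONE DIRTY CHORD** (every slack, all sharing patterns; inside the core-bound induction).  An X-connected terminal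
core in which any two chords that are not outside-gated coincide has no non-empty leafless set of non-chords. -/
theorem no_centre_of_dirty_le_one (hI : I.IsPure xorAndPred) (hT : Typed I) (hS : SimpleOverlap I) (hB : BoundaryExpanding r I)
    (ht : Terminal I r y K w₁ w₂)
    (hIH : ∀ c ∈ K, ∀ K₀ ⊆ K.erase c, ∀ d d' : Finset (Fin n) × Finset (Fin m) × Bool, Terminal I r y K₀ d d' → K₀.card ≤ 5)
    (hconn : XConnected I K)
    (hD : ∀ d₁ ∈ K, ∀ d₂ ∈ K, IsChord I K d₁ → ¬ OutsideGated I K (w₁.2.1 ∪ w₂.2.1) d₁ →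
      IsChord I K d₂ → ¬ OutsideGated I K (w₁.2.1 ∪ w₂.2.1) d₂ → d₁ = d₂) :
    ¬ ∃ S ⊆ K, S.Nonempty ∧ (∀ w ∈ xverts I S, 2 ≤ xpdeg I S w) ∧ ∀ f ∈ S, ¬ IsChord I K f := by
  classical
  rintro ⟨S, hSK, hSne, hSL, hSnc⟩
  have hX : XorClosed I K := ht.2.1
  have hKr : K.card < r := ht.2.2.1
  set M := w₁.2.1 ∪ w₂.2.1 with hM
  have hbs := card_bdry_add_card_sharedSlots_le I K hX
  have hN := card_nonchords_le_card_sharedSlots I K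
  -- the skeleton: non-chords and at most one dirty chord
  set D := K.filter fun c => IsChord I K c ∧ ¬ OutsideGated I K M c with hDdef
  have hD1 : D.card ≤ 1 := card_le_one.2 fun d₁ hd₁ d₂ hd₂ => by
    obtain ⟨h₁, hc₁, ho₁⟩ := mem_filter.1 hd₁
    obtain ⟨h₂, hc₂, ho₂⟩ := mem_filter.1 hd₂
    exact hD d₁ h₁ d₂ h₂ hc₁ ho₁ hc₂ ho₂
  have hskel : skel I K M ⊆ nonchords I K ∪ D := by
    intro f hf
    obtain ⟨hfK, hnot⟩ := (mem_skel I).1 hf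
    by_cases hch : IsChord I K f
    · exact mem_union_right _ (mem_filter.2 ⟨hfK, hch, fun hO => hnot ⟨hch, hO⟩⟩)
    · exact mem_union_left _ ((mem_nonchords I).2 ⟨hfK, hch⟩)
  have hskelcard : (skel I K M).card ≤ (nonchords I K).card + 1 :=
    ((card_le_card hskel).trans (card_union_le _ _)).trans (by omega)
  have hu : (xverts I K).card ≤ (skel I K M).card := card_xverts_le_card_skel hI hT hS hB ht hIH hconn ⟨S, hSK, hSne, hSL, hSnc⟩
  set C := K.filter fun c => IsChord I K c ∧ OutsideGated I K M c with hC
  have hsplit : C.card + (skel I K M).card = K.card := by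
    have h1 := card_filter_add_card_filter_not (s := K) (fun c => IsChord I K c ∧ OutsideGated I K M c)
    have e : (K.filter fun c => ¬ (IsChord I K c ∧ OutsideGated I K M c)) = skel I K M := by
      ext f; rw [mem_filter, mem_skel]
    rw [e] at h1
    exact h1
  set C₂ := C.filter fun c => ∃ w ∈ xpair I c, degIn I K w = 2 with hC₂
  set C'' := C.filter fun c => ¬ ∃ w ∈ xpair I c, degIn I K w = 2 with hC''
  have hCsplit : C₂.card + C''.card = C.card := card_filter_add_card_filter_not _
  have hcov := covered_of_terminal hI hT hS hB ht
  have hC₂mem : ∀ c ∈ C₂, c ∈ K ∧ IsChord I K c ∧ OutsideGated I K M c ∧ ∃ w ∈ xpair I c, degIn I K w = 2 := fun c hc => by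
    obtain ⟨hcC, hw⟩ := mem_filter.1 hc
    obtain ⟨hcK, hch, hO⟩ := mem_filter.1 hcC
    exact ⟨hcK, hch, hO, hw⟩
  have h3 := three_le_card_xverts_of_leafless I hI hS hSne hSL
  -- refined injection: `#C'' ≥ t + 1 + #Y`
  set Y := (xverts I K \ xverts I S).filter fun v => ¬ degIn I K v = 2 with hY
  have hC₂f := card_deg2_chords_le_filter I hI hcov hC₂mem hSK hSL hSnc
  have hYsplit : ((xverts I K \ xverts I S).filter fun v => degIn I K v = 2).card + Y.card = (xverts I K \ xverts I S).card :=
    card_filter_add_card_filter_not _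
  have hVS : (xverts I K \ xverts I S).card + (xverts I S).card = (xverts I K).card := card_sdiff_add_card_eq_card (xverts_mono I hSK)
  have hC''5 : 2 * (bdry I K).card + 1 + Y.card ≤ C''.card + 3 * K.card := by omega
  -- members and fat chords at a vertex
  have memC'' : ∀ c ∈ C'', c ∈ K ∧ IsChord I K c ∧ OutsideGated I K M c ∧ ∀ w ∈ xpair I c, degIn I K w ≠ 2 := fun c hc => by
    obtain ⟨hcC, hno⟩ := mem_filter.1 hc
    obtain ⟨hcK, hch, hO⟩ := mem_filter.1 hcC
    push Not at hno
    exact ⟨hcK, hch, hO, hno⟩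
  -- at every XOR vertex: the fat chords reading it plus one non-clean member
  have fat_lt : ∀ w ∈ xverts I K, (C''.filter fun j => w ∈ varSet I j).card + 1 ≤ degIn I K w := by
    intro w hw
    obtain ⟨f, hf, hwf, hnot⟩ := hcov w hw
    unfold PstarSAClosure.degIn
    have hfC : f ∉ C''.filter fun j => w ∈ varSet I j := fun h => by
      obtain ⟨-, hch, hO, -⟩ := memC'' f (mem_filter.1 h).1
      exact hnot ⟨hch, hO⟩
    calc (C''.filter fun j => w ∈ varSet I j).card + 1 = (insert f (C''.filter fun j => w ∈ varSet I j)).card := by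
          rw [card_insert_of_notMem hfC]
      _ ≤ (K.filter fun j => w ∈ varSet I j).card := by
          refine card_le_card fun j hj => ?_
          rcases mem_insert.1 hj with rfl | hj
          · exact mem_filter.2 ⟨hf, mem_varSet_of_mem_xpair hwf⟩
          · obtain ⟨hjC, hwj⟩ := mem_filter.1 hj
            exact mem_filter.2 ⟨(memC'' j hjC).1, hwj⟩
  -- `W₁`: the vertices all of whose members but one are fat chords
  set W₁ := (xverts I K).filter fun w => degIn I K w = (C''.filter fun j => w ∈ varSet I j).card + 1 with hW₁
  have hW₁fat : ∀ w ∈ W₁, ∃ c ∈ C'', w ∈ varSet I c := by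
    intro w hw
    obtain ⟨hwK, hdw⟩ := mem_filter.1 hw
    by_contra h
    push Not at h
    have h0 : (C''.filter fun j => w ∈ varSet I j).card = 0 := card_eq_zero.2 (filter_eq_empty_iff.2 fun j hj hwj => h j hj hwj)
    rw [h0] at hdw
    -- degree one: an XOR vertex of `K` on the boundary
    obtain ⟨f, hf, hwf⟩ := (mem_xverts_iff I K w).1 hwK
    have hb : w ∈ bdry I K := (mem_bdry_iff I K w).2 hdw
    rcases (mem_xpair I).1 hwf with h | h
    · exact hX f hf 0 (by decide) (h ▸ hb)
    · exact hX f hf 1 (by decide) (h ▸ hb)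
  -- `W₁ ⊆ Y`
  have hW₁Y : W₁ ⊆ Y := by
    intro w hw
    obtain ⟨hwK, hdw⟩ := mem_filter.1 hw
    obtain ⟨c, hc, hwc⟩ := hW₁fat w hw
    obtain ⟨hcK, hch, hO, hno⟩ := memC'' c hc
    have hwx : w ∈ xpair I c := by
      obtain ⟨f, hf, hwf⟩ := (mem_xverts_iff I K w).1 hwK
      rcases (mem_xpair I).1 hwf with h | h
      · rw [h]; exact mem_xpair_of_mem_varSet hT (s := 0) (by decide) (h ▸ hwc)
      · rw [h]; exact mem_xpair_of_mem_varSet hT (s := 1) (by decide) (h ▸ hwc)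
    refine mem_filter.2 ⟨mem_sdiff.2 ⟨hwK, fun hwS => ?_⟩, hno w hwx⟩
    -- a centre vertex carries two members of `S`, which are not fat chords
    obtain ⟨s₁, hs₁, -, hws₁⟩ := exists_ne_of_two_le_xpdeg I hI c (hSL w hwS)
    obtain ⟨s₂, hs₂, hs₂₁, hws₂⟩ := exists_ne_of_two_le_xpdeg I hI s₁ (hSL w hwS)
    have hsC : ∀ s ∈ S, s ∉ C''.filter fun j => w ∈ varSet I j := fun s hs h =>
      hSnc s hs (memC'' s (mem_filter.1 h).1).2.1
    have hle : (C''.filter fun j => w ∈ varSet I j).card + 2 ≤ degIn I K w := by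
      unfold PstarSAClosure.degIn
      have hs₁f : s₁ ∉ C''.filter fun j => w ∈ varSet I j := hsC s₁ hs₁
      have hs₂f : s₂ ∉ insert s₁ (C''.filter fun j => w ∈ varSet I j) := fun h => by
        rcases mem_insert.1 h with h | h
        · exact hs₂₁ h
        · exact hsC s₂ hs₂ h
      calc (C''.filter fun j => w ∈ varSet I j).card + 2 = (insert s₂ (insert s₁ (C''.filter fun j => w ∈ varSet I j))).card := by
            rw [card_insert_of_notMem hs₂f, card_insert_of_notMem hs₁f]
        _ ≤ (K.filter fun j => w ∈ varSet I j).card := by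
            refine card_le_card fun j hj => ?_
            rcases mem_insert.1 hj with rfl | hj
            · exact mem_filter.2 ⟨hSK hs₂, mem_varSet_of_mem_xpair hws₂⟩
            rcases mem_insert.1 hj with rfl | hj
            · exact mem_filter.2 ⟨hSK hs₁, mem_varSet_of_mem_xpair hws₁⟩
            · obtain ⟨hjC, hwj⟩ := mem_filter.1 hj
              exact mem_filter.2 ⟨(memC'' j hjC).1, hwj⟩
    omega
  -- keep one fat chord at each vertex of `W₁`, delete the other fat chords
  choose κ hκC hκw using hW₁fat
  obtain ⟨s₀, hs₀⟩ := hSne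
  set kf : Fin n → Fin m := fun w => if h : w ∈ W₁ then κ w h else s₀ with hkf
  set Kept := W₁.image kf with hKept
  have hKeptC : Kept ⊆ C'' := by
    intro j hj
    obtain ⟨w, hw, rfl⟩ := mem_image.1 hj
    simp only [hkf, dif_pos hw]
    exact hκC w hw
  have hKeptW : Kept.card ≤ W₁.card := card_image_le
  set R := C'' \ Kept with hR
  have hRK : R ⊆ K := fun j hj => (memC'' j (mem_sdiff.1 hj).1).1
  have hRch : ∀ c ∈ R, IsChord I K c := fun j hj => (memC'' j (mem_sdiff.1 hj).1).2.1
  have hRdeg : ∀ c ∈ R, ∀ w ∈ xpair I c, 2 + (R.filter fun j => w ∈ varSet I j).card ≤ degIn I K w := by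
    intro c hc w hw
    have hcC'' : c ∈ C'' := (mem_sdiff.1 hc).1
    have hwK : w ∈ xverts I K := (mem_xverts_iff I K w).2 ⟨c, (memC'' c hcC'').1, hw⟩
    have hsub : (R.filter fun j => w ∈ varSet I j) ⊆ C''.filter fun j => w ∈ varSet I j := filter_subset_filter _ sdiff_subset
    have hfl := fat_lt w hwK
    by_cases hwW : w ∈ W₁
    · -- the kept chord at `w` is fat, reads `w`, and is not deleted
      have hkw : kf w ∈ C''.filter fun j => w ∈ varSet I j := by
        simp only [hkf, dif_pos hwW]
        exact mem_filter.2 ⟨hκC w hwW, hκw w hwW⟩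
      have hkR : kf w ∉ R.filter fun j => w ∈ varSet I j := fun h =>
        (mem_sdiff.1 (mem_filter.1 h).1).2 (mem_image.2 ⟨w, hwW, rfl⟩)
      have hlt : (R.filter fun j => w ∈ varSet I j).card < (C''.filter fun j => w ∈ varSet I j).card :=
        card_lt_card ⟨hsub, fun h => hkR (h hkw)⟩
      have := (mem_filter.1 hwW).2
      omega
    · have hne : degIn I K w ≠ (C''.filter fun j => w ∈ varSet I j).card + 1 := fun h => hwW (mem_filter.2 ⟨hwK, h⟩)
      have := card_le_card hsub
      omega
  have hdel := card_bdry_sdiff_add_le I hI K R hRK hRch hRdeg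
  have hexp := hB (K \ R) ((card_le_card sdiff_subset).trans hKr.le)
  have hKR : (K \ R).card + R.card = K.card := card_sdiff_add_card_eq_card hRK
  have hR2 : R.card + 3 * K.card ≤ 2 * (bdry I K).card := by omega
  have hRcard : R.card + Kept.card = C''.card := by rw [hR, card_sdiff_add_card_eq_card hKeptC]
  have hWY := card_le_card hW₁Y
  omega

/-- **NO CENTRE WHEN EVERY CHORD IS OUTSIDE-GATED** (every slack). -/
theorem no_centre_of_clean (hI : I.IsPure xorAndPred) (hT : Typed I) (hS : SimpleOverlap I) (hB : BoundaryExpanding r I)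
    (ht : Terminal I r y K w₁ w₂)
    (hIH : ∀ c ∈ K, ∀ K₀ ⊆ K.erase c, ∀ d d' : Finset (Fin n) × Finset (Fin m) × Bool, Terminal I r y K₀ d d' → K₀.card ≤ 5)
    (hconn : XConnected I K) (hclean : ∀ c ∈ K, IsChord I K c → OutsideGated I K (w₁.2.1 ∪ w₂.2.1) c) :
    ¬ ∃ S ⊆ K, S.Nonempty ∧ (∀ w ∈ xverts I S, 2 ≤ xpdeg I S w) ∧ ∀ f ∈ S, ¬ IsChord I K f :=
  no_centre_of_dirty_le_one hI hT hS hB ht hIH hconn fun d₁ hd₁ _ _ hc₁ ho₁ _ _ => absurd (hclean d₁ hd₁ hc₁) ho₁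

/-- **A CENTRE FORCES TWO DIRTY CHORDS** (every slack, all sharing patterns; inside the induction): an X-connected terminal core with a non-empty
leafless set of non-chords has two distinct chords that are not outside-gated. -/
theorem exists_two_dirty_of_centre (hI : I.IsPure xorAndPred) (hT : Typed I) (hS : SimpleOverlap I) (hB : BoundaryExpanding r I)
    (ht : Terminal I r y K w₁ w₂)
    (hIH : ∀ c ∈ K, ∀ K₀ ⊆ K.erase c, ∀ d d' : Finset (Fin n) × Finset (Fin m) × Bool, Terminal I r y K₀ d d' → K₀.card ≤ 5)
    (hconn : XConnected I K) (hcentre : ∃ S ⊆ K, S.Nonempty ∧ (∀ w ∈ xverts I S, 2 ≤ xpdeg I S w) ∧ ∀ f ∈ S, ¬ IsChord I K f) :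
    ∃ d₁ ∈ K, ∃ d₂ ∈ K, d₁ ≠ d₂ ∧ IsChord I K d₁ ∧ ¬ OutsideGated I K (w₁.2.1 ∪ w₂.2.1) d₁ ∧
      IsChord I K d₂ ∧ ¬ OutsideGated I K (w₁.2.1 ∪ w₂.2.1) d₂ := by
  by_contra h
  push Not at h
  exact no_centre_of_dirty_le_one hI hT hS hB ht hIH hconn
    (fun d₁ hd₁ d₂ hd₂ hc₁ ho₁ hc₂ ho₂ => by_contra fun hne => ho₂ (h d₁ hd₁ d₂ hd₂ hne hc₁ ho₁ hc₂)) hcentre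

/-- **SLACK AT LEAST TWO, AGAIN** (every sharing pattern; inside the induction): an X-connected terminal core with a centre has
`3·#K + 2 ≤ 2·#bdry K` — now as a corollary of the two dirty chords and `card_dirty_le_slack`. -/
theorem two_le_slack_of_centre (hI : I.IsPure xorAndPred) (hT : Typed I) (hS : SimpleOverlap I) (hB : BoundaryExpanding r I)
    (ht : Terminal I r y K w₁ w₂)
    (hIH : ∀ c ∈ K, ∀ K₀ ⊆ K.erase c, ∀ d d' : Finset (Fin n) × Finset (Fin m) × Bool, Terminal I r y K₀ d d' → K₀.card ≤ 5)
    (hconn : XConnected I K) (hcentre : ∃ S ⊆ K, S.Nonempty ∧ (∀ w ∈ xverts I S, 2 ≤ xpdeg I S w) ∧ ∀ f ∈ S, ¬ IsChord I K f) :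
    3 * K.card + 2 ≤ 2 * (bdry I K).card := by
  classical
  obtain ⟨d₁, hd₁, d₂, hd₂, hne, hc₁, ho₁, hc₂, ho₂⟩ := exists_two_dirty_of_centre hI hT hS hB ht hIH hconn hcentre
  by_contra hlt
  have hslack : 2 * (bdry I K).card ≤ 3 * K.card + 1 := by omega
  have h := PstarChordReadTwoCleanCount.card_dirty_le_slack hB ht hslack (𝒟 := {d₁, d₂})
    (fun d hd => by
      rcases mem_insert.1 hd with rfl | hd
      · exact hd₁
      · rw [mem_singleton.1 hd]; exact hd₂)
    (fun d hd => by
      rcases mem_insert.1 hd with rfl | hd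
      · exact hc₁
      · rw [mem_singleton.1 hd]; exact hc₂)
    (fun d hd => by
      rcases mem_insert.1 hd with rfl | hd
      · exact ho₁
      · rw [mem_singleton.1 hd]; exact ho₂)
  rw [card_pair hne] at h
  omega

end Summit.PneNP.PneNP.Theorems.PstarCentreTwoDirty
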